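import Summits.BirchSwinnertonDyer.BirchSwinnertonDyer.Theorems.ByReductionTypeAtTwoSupersingularPinch
import HarnessLib

/-!
# Route `ByReductionTypeAtTwo` (rung K4), crux `SupersingularRankZeroAtTwo` (item
# stmt-BirchSwinnertonDyer-19097), line `signed_halves_two` v3: the ROW RESIDUAL modulo the descent half
# — what is left of the whole good-supersingular-at-2 row once `ord₂ #Ш_an ≤ ord₂ #Ш` is granted is
# KATO-SIDE ONLY (seat `bsd-2adic-ss-1`, GEN 5)

HONEST FRAMING (cell `bsd-2adic`, run/shared/lean/pub/bsd-2adic/, HUMAN RULINGS D-0036/D-0059/D-0074):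
ONE composition theorem against the registered crux constant; every research input an explicit
hypothesis; no definition, no named fact, no `sorry`; nothing booked; BSD is not proved by any of this.
PARTITION (D-0054): X5@2 good-ss (B1·O1; 757 r0 book230 classes = a₂ = 0 : 208, a₂ = ±2 : 549) × p = 2 —
types-the-object-of; closes none. bears_on: K4 (route-BirchSwinnertonDyer-ByReductionTypeAtTwo item 19097).

## What is proved

`supersingularRankZeroAtTwo_of_katoSide_of_rowLower_of_traceTwoUpper`: the crux from
* the registered stubs (1) `stub_ssPub`, (2) `stub_zeroSignedEulerChar`, (4) `stub_zeroSignedUpper`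
  (signatures VERBATIM) — the KATO SIDE of the `a₂ = 0` sub-row at `2`;
* ONE descent statement for the WHOLE row, with NO `a₂`-split: `MissingLowerBoundAt W 2`
  (`ord₂ #Ш_an ≤ ord₂ #Ш`) for every non-CM `W` of analytic rank `0` with good supersingular reduction
  at `2` — per class a finite certificate (`#Ш_an = q`, `v₂ q ≤ m`, `2^m ∣ #Ш`: eng-2's TWO-ENGINE
  Cassels–Tate certificate CERT-CT2-X5ALL gives `m = 4` at every rank-`0` member of the 705 K = 2
  classes; the 52 K ≥ 3 classes need level `≥ 3`), conjecture-shaped only as a ∀-statement;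
* the Kato/Euler-system half `MissingUpperBoundAt W 2` on the `a₂ = ±2` sub-row ALONE (the sub-row's
  sign-free typed door is the cell's `X5.O1.KatoHTwoBoundAtTwo` with its slack-one consumer
  `O1.bsdp_two_of_katoHTwo_of_slack_le_one`, per-pair ledgers; no `♯/♭` Selmer object at `2` exists —
  Sprung 2012 §7 "assume `p` is odd").
Proof: the rank-zero pinch (`supersingularRankZeroAtTwo_of_eulerChar_of_upper_of_millerHalves`, p450683:
given stubs (1)(2)(4) the hardest stub `stub_zeroKobayashiLower` IS the descent half on `a₂ = 0`) with the
row-wide descent statement restricted to each sub-row. So, modulo the descent half (certificate currency),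
the ∀-residual of the ENTIRE good-supersingular row at `2` is KATO-SIDE ONLY: {Kim's signed Euler
characteristic at `2`, the Kato-side signed divisibility at `2`} on `a₂ = 0` (MEMO-BOUND: printed for odd
`p`, computed local evidence at `2`) and the unsigned Euler-system upper bound on `a₂ = ±2` (MATH-BOUND resp. MEMO-BOUND:
Kato §§12–14 at `p = 2`). The Eisenstein / Beilinson–Flach / BSTW-type LOWER technology is NOT on the
critical path of this row in rank `0`.

References: S. Kobayashi, Invent. Math. 152 (2003) Thm. 1.2, Thm. 4.1 [Kobayashi2003]; B. D. Kim, J. Aust.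
Math. Soc. 95 (2013) Cor. 3.15 [BDKim2013]; F. Sprung, JNT 132 (2012) §7 [Sprung2012]; K. Kato, Astérisque
295 (2004) Thm. 14.5 [Kato2004Asterisque]; R. L. Miller, LMS JCM 14 (2011) Def. 1.1 [Miller2011LMS];
J. W. S. Cassels 1998 §1 [Cassels1998].
-/

set_option autoImplicit false
-- the Theorems namespace of this sub repeats the summit name by design (D-0017 nested layout)
set_option linter.dupNamespace false

noncomputable section

open scoped Classical MatrixGroups ModularForm

open CongruenceSubgroup WeierstrassCurve Literature.NumberTheory.EllipticCurves
  Literature.NumberTheory.EllipticCurves.ModularForms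
  Literature.NumberTheory.EllipticCurves.Rank1Residual Literature.NumberTheory.EllipticCurves.Rank1Residual.Typed
  Literature.NumberTheory.EllipticCurves.Kobayashi2003 Literature.NumberTheory.EllipticCurves.IwasawaDual
  ZpExtension Summit.BirchSwinnertonDyer.Rank1Residual Summit.BirchSwinnertonDyer.Rank1Residual.Supersingular

namespace Summit.BirchSwinnertonDyer.BirchSwinnertonDyer.Theorems

/-- **THE ROW RESIDUAL MODULO THE DESCENT HALF IS KATO-SIDE ONLY.** The crux `SupersingularRankZeroAtTwo`
from: the registered stubs (1) `hPub`, (2) `hEC` (Kim's signed `Γ`-Euler characteristic at `2` on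
`Sel⁺(E/ℚ_∞)`, `a₂ = 0`), (4) `hup` (the Kato-side signed divisibility at `2`, `a₂ = 0`) — signatures
verbatim; ONE row-wide descent statement `hLowRow` (`MissingLowerBoundAt W 2` for every non-CM rank-`0`
`W` with good supersingular reduction at `2`, no `a₂`-split; per class a finite Cassels–Tate / descent
certificate); and the Euler-system half `hUpTwo` (`MissingUpperBoundAt W 2`) on the `a₂ = ±2` sub-row
alone. Via the rank-zero pinch `supersingularRankZeroAtTwo_of_eulerChar_of_upper_of_millerHalves`.
Composition certificate; nothing asserted beyond the binders. [cite: Kobayashi2003, Thm. 1.2 and Thm. 4.1]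
[cite: BDKim2013, Cor. 3.15 (p. 199)] [cite: Sprung2012, §7 (p. 1499)] [cite: Miller2011LMS, Def. 1.1] -/
theorem supersingularRankZeroAtTwo_of_katoSide_of_rowLower_of_traceTwoUpper
    (hPub : nonempty_modularParametrizationData ∧ rank_eq_analyticRank_of_analyticRank_le_one)
    (hEC : ∀ (W : WeierstrassCurve ℚ) [W.IsElliptic] [W.IsGloballyMinimal],
        ¬ W.HasCM → W.analyticRank = 0 → GoodSS W 2 → W.frobeniusTrace 2 = 0 →
        ∀ (κ : ZpExtension ℚ 2) (γ : Field.absoluteGaloisGroup ℚ),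
          κ.IsCyclotomic → κ.IsTopGenerator γ → Finite (W.selmerGroupPInfty 2) →
          Finite (endInvariants (conjSignedSelmerInfty W κ 1 γ - 1)) ∧
            ∃ u : ℤ_[2]ˣ, (Nat.card (endInvariants (conjSignedSelmerInfty W κ 1 γ - 1)) : ℚ_[2]) =
              ((u : ℤ_[2]) : ℚ_[2]) * ((2 : ℕ) : ℚ_[2]) ^ (padicValNat 2 W.tamagawaProduct) *
                (Nat.card (W.selmerGroupPInfty 2) : ℚ_[2]) *
                  (Nat.card (EndCoinvariants (conjSignedSelmerInfty W κ 1 γ - 1)) : ℚ_[2]))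
    (hup : ∀ (W : WeierstrassCurve ℚ) [W.IsElliptic] [W.IsGloballyMinimal],
      ¬ W.HasCM → W.analyticRank = 0 → GoodSS W 2 → W.frobeniusTrace 2 = 0 →
      ∀ (κ : ZpExtension ℚ 2) (γ : Field.absoluteGaloisGroup ℚ),
        κ.IsCyclotomic → κ.IsTopGenerator γ → IsCyclotomicVariable 2 γ →
        ∀ [NeZero (W.conductorNorm ℤ)] (f : CuspForm (Gamma0 (W.conductorNorm ℤ)) 2),
          IsNewformOf W f → ∀ (ϖ : ℚ), (ϖ : ℝ) * W.realPeriodRat = plusPeriod f →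
        ∀ (Lplus Lminus : IwasawaAlgebra 2), IsPollackPair f 2 Lplus Lminus →
        ∀ (D : SignedSelmerDualData W κ γ 1),
          ∃ g h : IwasawaAlgebra 2, D.charIdeal = Ideal.span {g} ∧
            iwasawaToPowerSeries 2 (g * h) =
              PowerSeries.C (ϖ : ℚ_[2]) * iwasawaToPowerSeries 2 (kobayashiL 1 Lplus Lminus))
    (hLowRow : ∀ (W : WeierstrassCurve ℚ) [W.IsElliptic] [W.IsGloballyMinimal],
      ¬ W.HasCM → W.analyticRank = 0 → GoodSS W 2 → MissingLowerBoundAt W 2)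
    (hUpTwo : ∀ (W : WeierstrassCurve ℚ) [W.IsElliptic] [W.IsGloballyMinimal],
      ¬ W.HasCM → W.analyticRank = 0 → GoodSS W 2 →
        (W.frobeniusTrace 2 = 2 ∨ W.frobeniusTrace 2 = -2) → MissingUpperBoundAt W 2) :
    Summit.BirchSwinnertonDyer.BirchSwinnertonDyer.Theses.ByReductionTypeAtTwo.SupersingularRankZeroAtTwo :=
  supersingularRankZeroAtTwo_of_eulerChar_of_upper_of_millerHalves hPub hEC hup
    (fun W _ _ hcm hr hss _ ↦ hLowRow W hcm hr hss)
    ⟨fun W _ _ hcm hr hss _ ↦ hLowRow W hcm hr hss, hUpTwo⟩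

end Summit.BirchSwinnertonDyer.BirchSwinnertonDyer.Theorems

end
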